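import Summits.ResolutionOfSingularities.ResolutionOfSingularities.Theorems.PicoverToRadicialBottom.Negative.RadicialCoverCriteria
import Summits.ResolutionOfSingularities.ResolutionOfSingularities.Theorems.WeightedThesis.Negative.LoadBearing
import Literature.AlgebraicGeometry.Resolution.ProjectiveSpaceRegular

/-!
# `PicoverToRadicialBottom` — negative lemma: regularity does not descend along finite radicial covers

Support (negative) lemma for crux `stmt-ResolutionOfSingularities-0556`
(`Summit.ResolutionOfSingularities.ResolutionOfSingularities.Theses.PAlteration.PicoverToRadicialBottom`),
filed by the standing disprover (cdisprove gen 1; work file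
`Cruxes/PicoverToRadicialBottom/Disproof.lean`; companions `Negative/LoadBearing.lean`,
`Negative/RadicialCoverCriteria.lean`). No definition, no notation.

* `radicialBottom_strengthening_isRegular_false` — the natural STRENGTHENING of the crux's
  consequent with `Scheme.IsRegular` in place of `Scheme.HasResolution` on both sides ("regularity
  descends along finite, universally injective, surjective morphisms of integral varieties") is
  FALSE at every prime: the normalisation `Spec 𝔽_p[T] → Spec 𝔽_p[T², T³]` of the cuspidal cubic is
  finite, surjective and universally injective (`Negative/RadicialCoverCriteria.lean`), its source is
  regular and its target is not (`WeightedThesis.Negative.not_isRegular_spec_cusp`). The crux is about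
  birational MODIFICATIONS; its conclusion cannot be upgraded to regularity of `X`, and (dually)
  `Picover` cannot be attacked by transferring regularity up or down a radicial cover.

## Sources
* The Stacks Project, Tag 01S4. H. Matsumura, *Commutative Ring Theory*, Thm. 19.4 (regular local
  ⇒ normal), via the tree's cusp. Folklore.
-/

noncomputable section

open CategoryTheory CategoryTheory.Limits AlgebraicGeometry TensorProduct Polynomial
open Literature.AlgebraicGeometry.Resolution

set_option linter.dupNamespace false

namespace Summit.ResolutionOfSingularities.ResolutionOfSingularities.Theorems.PicoverToRadicialBottom.Negative

/-- **Strengthening refuted, at every prime: regularity (as opposed to resolvability) does NOT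
descend along finite radicial surjections of integral varieties** — the crux's conclusion cannot be
upgraded from `HasResolution` to `Scheme.IsRegular`. Witness over `𝔽_p`: the normalisation
`Spec 𝔽_p[T] → Spec 𝔽_p[T², T³]` of the cuspidal cubic: finite, surjective, universally injective
(the kernel of `𝔽_p[T] ⊗_{𝔽_p[T²,T³]} 𝔽_p[T] → 𝔽_p[T]` is generated by `1 ⊗ T − T ⊗ 1`, whose
cube vanishes), with regular source and non-regular target (`not_isRegular_spec_cusp`).
[folklore] -/
theorem radicialBottom_strengthening_isRegular_false (p : ℕ) [Fact p.Prime] :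
    ¬ ∀ (k : Type) [Field k] [CharP k p] (Y Y'' : Scheme.{0}) (f : Y ⟶ Spec (.of k))
        (g : Y'' ⟶ Y), IsSeparated f → LocallyOfFiniteType f → QuasiCompact f → IsIntegral Y →
          IsIntegral Y'' → IsFinite g → UniversallyInjective g → Function.Surjective g.base →
            Scheme.IsRegular Y'' → Scheme.IsRegular Y := by
  intro h
  let B : Subalgebra (ZMod p) (ZMod p)[X] :=
    Algebra.adjoin (ZMod p) ({X ^ 2, X ^ 3} : Set (ZMod p)[X])
  haveI : Algebra.FiniteType (ZMod p) ↥B := by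
    refine ⟨(Subalgebra.fg_top B).mpr ⟨{X ^ 2, X ^ 3}, ?_⟩⟩
    simp [B]
  let f : Spec (.of ↥B) ⟶ Spec (.of (ZMod p)) :=
    Spec.map (CommRingCat.ofHom (algebraMap (ZMod p) ↥B))
  haveI : LocallyOfFiniteType f :=
    (HasRingHomProperty.Spec_iff (P := @LocallyOfFiniteType)).mpr
      (RingHom.finiteType_algebraMap.mpr inferInstance)
  let g : Spec (.of (ZMod p)[X]) ⟶ Spec (.of ↥B) :=
    Spec.map (CommRingCat.ofHom (algebraMap (↥B) (ZMod p)[X]))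
  haveI : IsFinite g := isFinite_cuspNormalization (ZMod p)
  haveI : UniversallyInjective g := universallyInjective_cuspNormalization (ZMod p)
  exact _root_.Summit.ResolutionOfSingularities.ResolutionOfSingularities.Theorems.WeightedThesis.Negative.not_isRegular_spec_cusp
    (ZMod p)
    (h (ZMod p) (Spec (.of ↥B)) (Spec (.of (ZMod p)[X])) f g inferInstance inferInstance
      inferInstance inferInstance inferInstance inferInstance inferInstance
      (surjective_cuspNormalization (ZMod p)) (Scheme.isRegular_Spec (CommRingCat.of (ZMod p)[X])))

end Summit.ResolutionOfSingularities.ResolutionOfSingularities.Theorems.PicoverToRadicialBottom.Negative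

end
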